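import Literature.IUT.HodgeArakelov.GMonoidFrobenioids
import Literature.IUT.HodgeTheaters.GaloisValDatumCoveringMonoid
import HarnessLib

/-!
# The `U`-invariants of the `G_v`-monoid `𝒪^▷_{K̄_v}` ARE the integers `𝒪^▷_{Ω^U}` of the field of `G_v/U`, naturally in
# `G_v/U` — the GENUINE [FrdII] Ex. 1.1 (ii) reading of [IUTchII] Def. 4.9 (i) / Def. 3.8 (i) objectwise
# (junction L5 × L6 × L1: MERGE-MAP rows B16 (ii) and R-Def38-a, field level)

Mochizuki, *The geometry of Frobenioids II*, Kyushu J. Math. **62** (2008), §1 Ex. 1.1 (i) p. 7 «the assignment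
`Spec K ↦ 𝒪^▷_K` … `ord(𝒪^▷_K) := 𝒪^▷_K/𝒪^×_K`» and (ii) p. 8 «`p`-adic Frobenioids» over a base `D → D₀`
[cite: MochizukiFrdII2008, Ex 1.1 (i) p.7]; Mochizuki, *Inter-universal Teichmüller Theory II*, kurims manuscript
(Dec. 2020), Def. 4.9 (i) p. 154 «the monoid `𝒪^▷(A)` equipped with a natural action by `G` … obtained by evaluating
the monoid `𝒪^▷(−)` on `D` at `A`» and Def. 3.8 (i) p. 113 «gives rise to a `p_v`-adic Frobenioid … [cf. [FrdII],
Example 1.1, (ii)] … whose divisor monoid associates to every object of `B^temp(Π_X(M^Θ_*))⁰` a monoid …»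
[cite: Mochizuki2012, II Def 4.9 (i) p.154] (D-0012 claim key, status disputed; nothing of the series is asserted).

abc-iut cell, seat abc-iut-L6-t7 (gen 4, MERGE-MAP writer); row «B16-ii INVARIANTS = INTEGERS» (INTENT 17:11:50Z),
the junction of abc-iut-L5-t2's B16 (i) `GaloisValDatum.coveringMonoid` (p456702: the `G_v`-monoid `𝒪^▷_{K̄_v}` with
(lim-1) `galAct_fixed_iff_exists_fixedFld`, (lim-3) `galAct_fixedHom`) with abc-iut-w4-d019's R-Def38-a (A)
`CoveringMonoid.invariants / pull / invariantsFunctor / divisorFunctor` (p455796) and abc-iut-L1's [FrdII] Ex. 1.1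
vocabulary `PadicFrd.intNonzero` / `intNonzeroMapOfHom` / `OrdInt` / `ordIntMapOfHom` over abc-iut-L5-t2's field functor
`GaloisValDatum.fieldFunctor : CosetCat G_v ⥤ PadicFld` (`GaloisCosetFields.lean`).  DEF-BEARING junction, class (b):
`MulEquiv`/functor definitions over existing interfaces + theorems; 0 instances / notation / `Prop` facts; nothing
landed is edited or re-declared.  Elements are moved between the carriers `↥(intNonzero Ω)` (= `d.coveringMonoid.O`)
and `(d.fieldFunctor.obj X).K` (= `↥(Ω^U)` with `valOn`) by structure projections (`.1`), never by new coercions.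

WHAT IS CONSTRUCTED / PROVED (for every `d : GaloisValDatum p` and every object `G_v/U` of `D⊢_v = CosetCat d.Gal`):
* `mem_invariants_coveringMonoid_iff` — `x ∈ (𝒪^▷_{K̄_v})^U ↔ ∀ σ ∈ U, σ x = x`; `coe_mem_fixedFld_of_mem_invariants`;
  `toFixedInt` / `ofFixedInt` — the two directions «`U`-invariant nonzero integer of `Ω` ↔ nonzero integer of `Ω^U`»
  (the Frobenioid's valuation `valOn` of `Ω^U` IS the restriction of that of `Ω`: `coe_mem_intNonzero`);
* **`invariantsEquiv d X : d.coveringMonoid.invariants U ≃* intNonzero (d.fieldFunctor.obj X).K`** — (A)'s value `Ψ^U`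
  of the monoid `G_v/U ↦ Ψ^U` at the GENUINE covering monoid IS abc-iut-L1's «`Spec Ω^U ↦ 𝒪^▷_{Ω^U}`» ([FrdII] Ex. 1.1 (i));
* **`invariantsEquiv_natural`** — along `f : G_v/U → G_v/V` the square with (A)'s `CoveringMonoid.pull f` and L1's
  `intNonzeroMapOfHom (d.fieldFunctor.map f).alg` commutes (lim-3: both are «`x ↦ g·x`» for a representative `g` of
  `pt f`); packaged as a natural isomorphism **`invariantsFunctorIso d : d.coveringMonoid.invariantsFunctor ≅
  d.integersFunctor`**, where `integersFunctor d : (CosetCat G_v)ᵒᵖ ⥤ CommMonCat`, `G_v/U ↦ 𝒪^▷_{Ω^U}`, is L1's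
  `intNonzero` / `intNonzeroMapOfHom` read along `fieldFunctor` (the monoid `𝒪^▷(−)` of the `p_v`-adic Frobenioid `C_v`
  ON ITS BASE, [IUTchI] Ex. 3.3 (i) «these monoids … determine `p_v`-adic Frobenioids»);
* **`divisorEquiv d X : Associates (d.coveringMonoid.invariants U) ≃* OrdInt (d.fieldFunctor.obj X).K`**,
  `divisorEquiv_natural` (vs `ordIntMapOfHom`), `divisorFunctorObjEquiv` — (A)'s DIVISOR MONOID `divisorFunctor` of the
  genuine covering monoid is, objectwise and naturally, [FrdII] Ex. 1.1 (i)'s `ord(𝒪^▷_{Ω^U})` BEFORE realification: the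
  integral structure that abc-iut-L1's `Datum.perf` / realification turn into print's «≅ ℚ_{≥0}» for `F_cns` (R-Def38-a,
  field level); `exists_base_of_mem_invariants_top` (`(𝒪^▷_{K̄_v})^{G_v}` comes from `𝒪^▷_{K_v}`).
HONEST LIMITS: the perfection/realification step and the identification with a `PadicFrd.Datum`'s `effSubmonoid`
(abc-iut-L5-t2's named follow-up; the fibre-product `B`) are NOT done here; nothing asserts that the covering monoid
carries a Kummer structure; pure Galois/valuation bookkeeping over Mathlib and the tree's interfaces; no side taken on
[IUTchIII] Cor. 3.12; typed ≠ proved for anything of [IUTchI–III].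
-/

noncomputable section

namespace Literature.IUT.HodgeTheaters

open CategoryTheory Opposite Literature.AnabelianGeometry.SemiGraphs
  Literature.AlgebraicGeometry.Frobenioids Literature.AlgebraicGeometry.Frobenioids.PadicFrd
  Literature.IUT.HodgeArakelov

universe u

namespace GaloisValDatum

variable {p : ℕ} [Fact p.Prime] (d : GaloisValDatum.{u} p)

/-! ### Invariants of `𝒪^▷_{K̄_v}` under `U` and the field `Ω^U` -/

/-- `x ∈ (𝒪^▷_{K̄_v})^U` iff every `σ ∈ U` fixes `x ∈ Ω` (abc-iut-w4-d019's `CoveringMonoid.invariants` at abc-iut-L5-t2's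
`coveringMonoid`, unfolded through `galAct_eq_iff`). [cite: Mochizuki2012, II Def 4.9 (i) p.154] -/
theorem mem_invariants_coveringMonoid_iff (U : Subgroup d.Gal) (x : intNonzero d.Ω) :
    x ∈ d.coveringMonoid.invariants U ↔ ∀ σ ∈ U, σ (x : d.Ω) = x :=
  (CoveringMonoid.mem_invariants_iff d.coveringMonoid).trans (forall₂_congr fun σ _ => d.galAct_eq_iff σ x)

/-- A `U`-invariant element of `𝒪^▷_{K̄_v}` lies in the fixed field `Ω^U` of the object `G_v/U`.
[cite: MochizukiFrdII2008, Ex 1.1 (i) p.7] -/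
theorem coe_mem_fixedFld_of_mem_invariants (X : CosetCat d.Gal) {x : intNonzero d.Ω}
    (hx : x ∈ d.coveringMonoid.invariants (X.sg : Subgroup d.Gal)) : (x : d.Ω) ∈ d.fixedFld X :=
  (IntermediateField.mem_fixedField_iff _ _).mpr ((d.mem_invariants_coveringMonoid_iff _ x).mp hx)

/-- **`(𝒪^▷_{K̄_v})^U → 𝒪^▷_{Ω^U}`**: a `U`-invariant nonzero integer of `Ω` as a nonzero integer of the field `Ω^U` of `G_v/U`
(with the Frobenioid's restricted valuation `valOn`; lim-1 of abc-iut-L5-t2). [cite: MochizukiFrdII2008, Ex 1.1 (i) p.7] -/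
def toFixedInt (X : CosetCat d.Gal) (x : intNonzero d.Ω) (hx : x ∈ d.coveringMonoid.invariants (X.sg : Subgroup d.Gal)) :
    intNonzero (d.fieldFunctor.obj X).K :=
  ⟨(⟨x.1, d.coe_mem_fixedFld_of_mem_invariants X hx⟩ : d.fixedFld X), by
    obtain ⟨y, hy, hyx⟩ :=
      (d.galAct_fixed_iff_exists_fixedFld X x).mp ((CoveringMonoid.mem_invariants_iff d.coveringMonoid).mp hx)
    have h : (⟨x.1, d.coe_mem_fixedFld_of_mem_invariants X hx⟩ : d.fixedFld X) = y := Subtype.ext hyx.symm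
    rw [h]
    exact hy⟩

/-- `toFixedInt` does not change the underlying element of `Ω`. [cite: MochizukiFrdII2008, Ex 1.1 (i) p.7] -/
@[simp] theorem coe_coe_toFixedInt (X : CosetCat d.Gal) (x : intNonzero d.Ω)
    (hx : x ∈ d.coveringMonoid.invariants (X.sg : Subgroup d.Gal)) : (d.toFixedInt X x hx).1.1 = x.1 := rfl

/-- An element of a subfield `E ⊆ Ω` integral and nonzero for the RESTRICTED valuation `valOn E` (the one the Frobenioid
uses) is a nonzero integer of `Ω`. [cite: MochizukiFrdII2008, Ex 1.1 (i) p.7] -/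
theorem coe_mem_intNonzero_of_mem_on (E : IntermediateField d.k d.Ω) (y : E)
    (hy : y ∈ @intNonzero E _ (d.valOn E)) : (y : d.Ω) ∈ intNonzero d.Ω := by
  letI := d.valOn E
  refine ⟨?_, fun h0 => hy.2 (ZeroMemClass.coe_eq_zero.mp h0)⟩
  have h1 : y ≤ᵥ 1 := by
    rw [Valuation.Compatible.vle_iff_le (v := ValuativeRel.valuation E), map_one]
    exact hy.1
  rw [d.valOn_iff, OneMemClass.coe_one, Valuation.Compatible.vle_iff_le (v := ValuativeRel.valuation d.Ω),
    map_one] at h1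
  exact h1

/-- The Frobenioid's valuation of `Ω^U` is the restriction of that of `Ω`: a nonzero integer of `Ω^U` is a nonzero
integer of `Ω`. [cite: MochizukiFrdII2008, Ex 1.1 (i) p.7] -/
theorem coe_mem_intNonzero (X : CosetCat d.Gal) (y : intNonzero (d.fieldFunctor.obj X).K) : y.1.1 ∈ intNonzero d.Ω :=
  d.coe_mem_intNonzero_of_mem_on (d.fixedFld X) y.1 y.2

/-- **`𝒪^▷_{Ω^U} → (𝒪^▷_{K̄_v})^U`**: a nonzero integer of `Ω^U` is a `U`-invariant nonzero integer of `Ω` (lim-1, converse).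
[cite: MochizukiFrdII2008, Ex 1.1 (i) p.7] -/
def ofFixedInt (X : CosetCat d.Gal) (y : intNonzero (d.fieldFunctor.obj X).K) :
    d.coveringMonoid.invariants (X.sg : Subgroup d.Gal) :=
  ⟨(⟨y.1.1, d.coe_mem_intNonzero X y⟩ : intNonzero d.Ω),
    (d.mem_invariants_coveringMonoid_iff _ _).mpr fun σ hσ =>
      (IntermediateField.mem_fixedField_iff _ _).mp y.1.2 σ hσ⟩

/-- `ofFixedInt` does not change the underlying element of `Ω`. [cite: MochizukiFrdII2008, Ex 1.1 (i) p.7] -/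
@[simp] theorem coe_coe_ofFixedInt (X : CosetCat d.Gal) (y : intNonzero (d.fieldFunctor.obj X).K) :
    (d.ofFixedInt X y).1.1 = y.1.1 := rfl

/-- **The `U`-invariants of the `G_v`-monoid `𝒪^▷_{K̄_v}` ARE `𝒪^▷_{Ω^U}`**: abc-iut-w4-d019's value `Ψ^U` of the monoid
`G_v/U ↦ Ψ^U` ([IUTchII] Def 3.8 (i) / 4.9 (i) «evaluating the monoid `𝒪^▷(−)` on `D` at `A`», read backwards) at
abc-iut-L5-t2's GENUINE covering monoid is abc-iut-L1's [FrdII] Ex 1.1 (i) monoid «`Spec Ω^U ↦ 𝒪^▷_{Ω^U}`» of the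
field over which the object `G_v/U` of `D⊢_v` lies. [cite: MochizukiFrdII2008, Ex 1.1 (i) p.7] -/
def invariantsEquiv (X : CosetCat d.Gal) :
    d.coveringMonoid.invariants (X.sg : Subgroup d.Gal) ≃* intNonzero (d.fieldFunctor.obj X).K where
  toFun x := d.toFixedInt X x.1 x.2
  invFun y := d.ofFixedInt X y
  left_inv _ := Subtype.ext (Subtype.ext rfl)
  right_inv _ := Subtype.ext (Subtype.ext rfl)
  map_mul' _ _ := Subtype.ext (Subtype.ext rfl)

/-- `invariantsEquiv` does not change the underlying element of `Ω`. [cite: MochizukiFrdII2008, Ex 1.1 (i) p.7] -/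
@[simp] theorem coe_coe_invariantsEquiv (X : CosetCat d.Gal) (x : d.coveringMonoid.invariants (X.sg : Subgroup d.Gal)) :
    (d.invariantsEquiv X x).1.1 = x.1.1 := rfl

/-- `invariantsEquiv.symm` does not change the underlying element of `Ω`. [cite: MochizukiFrdII2008, Ex 1.1 (i) p.7] -/
@[simp] theorem coe_coe_invariantsEquiv_symm (X : CosetCat d.Gal) (y : intNonzero (d.fieldFunctor.obj X).K) :
    ((d.invariantsEquiv X).symm y).1.1 = y.1.1 := rfl

/-! ### Naturality in `G_v/U` (lim-3): (A)'s pull-backs are L1's restriction maps -/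

/-- **Naturality**: along `f : G_v/U → G_v/V` (point `g·V`), abc-iut-w4-d019's pull-back `CoveringMonoid.pull f` (action of
a representative `g` on `V`-invariants) corresponds under `invariantsEquiv` to abc-iut-L1's restriction map
`𝒪^▷_{Ω^V} → 𝒪^▷_{Ω^U}` along the field functor's `Ω^V → Ω^U`, `x ↦ g·x` (`intNonzeroMapOfHom (fieldFunctor.map f).alg`).
[cite: MochizukiFrdII2008, Ex 1.1 (ii) p.8] -/
theorem invariantsEquiv_natural {X Y : CosetCat d.Gal} (f : X ⟶ Y)
    (x : d.coveringMonoid.invariants (Y.sg : Subgroup d.Gal)) :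
    d.invariantsEquiv X (d.coveringMonoid.pull f x) =
      intNonzeroMapOfHom (d.fieldFunctor.map f).alg (d.fieldFunctor.map f).isValHom (d.invariantsEquiv Y x) := by
  obtain ⟨g, hg⟩ := Quotient.exists_rep (CosetCat.pt f)
  have hg' : CosetCat.pt f = ((g : d.Gal) : Y.carrier) := hg.symm
  apply Subtype.ext
  apply Subtype.ext
  change (d.coveringMonoid.pull f x).1.1 =
    (d.fixedHom f ⟨x.1.1, d.coe_mem_fixedFld_of_mem_invariants Y x.2⟩).1
  rw [d.coveringMonoid.coe_pull_eq_act f hg x, d.fixedHom_apply_coe f g hg']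
  rfl

/-- **`G_v/U ↦ 𝒪^▷_{Ω^U}` as a monoid on `D⊢_v = CosetCat G_v`**: abc-iut-L1's [FrdII] Ex 1.1 (i) `Spec K ↦ 𝒪^▷_K` /
`intNonzeroMapOfHom` read along abc-iut-L5-t2's field functor — the monoid `𝒪^▷(−)` of the `p_v`-adic Frobenioid `C_v`
on its base ([IUTchI] Ex 3.3 (i)). Functoriality = that of `fieldFunctor` (its maps act by `x ↦ g·x` on underlying
elements). [cite: Mochizuki2012, I Ex 3.3 (i) p.78] -/
def integersFunctor : (CosetCat d.Gal)ᵒᵖ ⥤ CommMonCat.{u} where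
  obj X := CommMonCat.of (intNonzero (d.fieldFunctor.obj (unop X)).K)
  map f := CommMonCat.ofHom
    (intNonzeroMapOfHom (d.fieldFunctor.map f.unop).alg (d.fieldFunctor.map f.unop).isValHom)
  map_id X := by
    apply CommMonCat.hom_ext
    apply MonoidHom.ext
    intro y
    apply Subtype.ext
    change (d.fieldFunctor.map (𝟙 (unop X))).alg y.1 = y.1
    rw [d.fieldFunctor.map_id]
    rfl
  map_comp {X Y Z} f g := by
    apply CommMonCat.hom_ext
    apply MonoidHom.ext
    intro y
    apply Subtype.ext
    change (d.fieldFunctor.map (g.unop ≫ f.unop)).alg y.1 =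
      (d.fieldFunctor.map g.unop).alg ((d.fieldFunctor.map f.unop).alg y.1)
    rw [d.fieldFunctor.map_comp]
    rfl

/-- The value of `integersFunctor` at `G_v/U` is `𝒪^▷_{Ω^U}`. [cite: Mochizuki2012, I Ex 3.3 (i) p.78] -/
theorem integersFunctor_obj (X : (CosetCat d.Gal)ᵒᵖ) :
    d.integersFunctor.obj X = CommMonCat.of (intNonzero (d.fieldFunctor.obj (unop X)).K) := rfl

/-- **The natural isomorphism `(G_v/U ↦ (𝒪^▷_{K̄_v})^U) ≅ (G_v/U ↦ 𝒪^▷_{Ω^U})` of monoids on `D⊢_v`**: abc-iut-w4-d019's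
`invariantsFunctor` of abc-iut-L5-t2's genuine covering monoid IS the [FrdII] Ex 1.1 (i) integer monoid on the base —
«evaluating `𝒪^▷(−)` at the universal covering» and «taking `U`-invariants» are mutually inverse, naturally.
[cite: Mochizuki2012, II Def 4.9 (i) p.154] -/
def invariantsFunctorIso : d.coveringMonoid.invariantsFunctor ≅ d.integersFunctor :=
  NatIso.ofComponents
    (fun X => (d.invariantsEquiv (unop X)).toCommMonCatIso)
    (fun {X Y} f => by
      apply CommMonCat.hom_ext
      apply MonoidHom.ext
      intro x
      exact d.invariantsEquiv_natural f.unop x)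

/-! ### Divisor monoids: (A)'s `divisorFunctor` objectwise is `ord(𝒪^▷_{Ω^U})` -/

/-- **(A)'s divisor monoid at `G_v/U` of the genuine covering monoid is `ord(𝒪^▷_{Ω^U}) = 𝒪^▷_{Ω^U}/𝒪^×_{Ω^U}`** ([FrdII]
Ex 1.1 (i) `Φ₀` before realification; [IUTchII] Def 3.8 (i) «whose divisor monoid associates to every object … a
monoid» — here the integral one; print's «≅ ℚ_{≥0}» is its perfection). [cite: MochizukiFrdII2008, Ex 1.1 (i) p.7] -/
def divisorEquiv (X : CosetCat d.Gal) :
    Associates (d.coveringMonoid.invariants (X.sg : Subgroup d.Gal)) ≃* OrdInt (d.fieldFunctor.obj X).K where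
  toFun := associatesMap (d.invariantsEquiv X).toMonoidHom
  invFun := associatesMap (d.invariantsEquiv X).symm.toMonoidHom
  left_inv a := by
    obtain ⟨x, rfl⟩ := Associates.mk_surjective a
    rw [associatesMap_mk, associatesMap_mk, MulEquiv.coe_toMonoidHom, MulEquiv.coe_toMonoidHom,
      MulEquiv.symm_apply_apply]
  right_inv a := by
    obtain ⟨x, rfl⟩ := Associates.mk_surjective a
    rw [associatesMap_mk, associatesMap_mk, MulEquiv.coe_toMonoidHom, MulEquiv.coe_toMonoidHom,
      MulEquiv.apply_symm_apply]
  map_mul' a b := map_mul _ a b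

/-- `divisorEquiv` on classes. [cite: MochizukiFrdII2008, Ex 1.1 (i) p.7] -/
theorem divisorEquiv_mk (X : CosetCat d.Gal) (x : d.coveringMonoid.invariants (X.sg : Subgroup d.Gal)) :
    d.divisorEquiv X (Associates.mk x) = Associates.mk (d.invariantsEquiv X x) := rfl

/-- **Naturality of `divisorEquiv`**: (A)'s `divisorFunctor` transition map (classes of `pull f`) corresponds to L1's
`ordIntMapOfHom` along the field functor. [cite: MochizukiFrdII2008, Ex 1.1 (ii) p.8] -/
theorem divisorEquiv_natural {X Y : CosetCat d.Gal} (f : X ⟶ Y)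
    (a : Associates (d.coveringMonoid.invariants (Y.sg : Subgroup d.Gal))) :
    d.divisorEquiv X (associatesMap (d.coveringMonoid.pull f) a) =
      ordIntMapOfHom (d.fieldFunctor.map f).alg (d.fieldFunctor.map f).isValHom (d.divisorEquiv Y a) := by
  obtain ⟨x, rfl⟩ := Associates.mk_surjective a
  rw [associatesMap_mk, divisorEquiv_mk, divisorEquiv_mk, ordIntMapOfHom_mk, d.invariantsEquiv_natural f x]

/-- (A)'s `divisorFunctor` at `G_v/U`, transported: the value `Φ(G_v/U)` of abc-iut-w4-d019's divisor monoid of the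
genuine covering monoid is isomorphic to `ord(𝒪^▷_{Ω^U})` — the objectwise form stated against `divisorFunctor` itself.
[cite: Mochizuki2012, II Def 4.9 (i) p.154] -/
def divisorFunctorObjEquiv (X : (CosetCat d.Gal)ᵒᵖ) :
    d.coveringMonoid.divisorFunctor.obj X ≃* OrdInt (d.fieldFunctor.obj (unop X)).K :=
  d.divisorEquiv (unop X)

/-- At the object `G_v/G_v = Spec K_v`: every `G_v`-invariant of `𝒪^▷_{K̄_v}` comes from `𝒪^▷_{K_v}` (abc-iut-L5-t2's
`forall_galAct_eq_iff_exists_base`, infinite Galois theory). [cite: MochizukiFrdII2008, Ex 1.1 (i) p.7] -/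
theorem exists_base_of_mem_invariants_top (x : intNonzero d.Ω)
    (hx : x ∈ d.coveringMonoid.invariants ((CosetCat.top : CosetCat d.Gal).sg : Subgroup d.Gal)) :
    ∃ a : intNonzero d.k, intNonzeroMap d.Ω d.k a = x :=
  (d.forall_galAct_eq_iff_exists_base x).mp fun σ =>
    (CoveringMonoid.mem_invariants_iff d.coveringMonoid).mp hx σ (OpenSubgroup.mem_top σ)

end GaloisValDatum

end Literature.IUT.HodgeTheaters

end
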